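import Mathlib
import Literature.AlgebraicGeometry.Resolution.CutkoskySurfaceOmega
import Literature.AlgebraicGeometry.Resolution.CurveBlowupPolygonLaws
import HarnessLib

/-!
# Cutkosky 2009, Lemma 10.13 (polygon part): `Ω` drops under the blow-up of the curve `V(z, x)`

Topic: `Literature/AlgebraicGeometry/Resolution`.  S. D. Cutkosky, Amer. J. Math. **131** (2009)
[cite: Cutkosky2009], §10.4: under the transformation **Tr3** (`Sing_r(I) = V(x, z)`; `x = x₁`,
`y = y₁`, `z = x₁ z₁`; `I₁ = (1/x₁^r) I T₁`, Def. 10.10 p. 31) the characteristic polygon moves by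
"`σ(a, b) = (a − 1, b)`" (Lemma 10.11 (3), p. 32 l. 13), and (Lemma 10.13, p. 32 l. 22–28)

> `β_{x₁y₁z₁}(I₁) = β_{xyz}(I)`, `δ_{x₁y₁z₁}(I₁) = δ_{xyz}(I)`, `ε_{x₁y₁z₁}(I₁) = ε_{xyz}(I)` and
> `α_{x₁y₁z₁}(I₁) = α_{xyz}(I) − 1`, `γ_{x₁y₁z₁}(I₁) = γ_{xyz}(I) − 1`,

whence, in the proof of Theorem 10.18 (p. 37 l. 5–10): "`α_{n+1} < α_n` and `Ω_{n+1} < Ω_n` by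
Lemma 10.13".  This file PROVES the `Ω`-part of these statements — `β′ = β`, **`ε′ = ε`** (Cutkosky's
slope `ε` = `Cutkosky2009.epsCu`), `α′ = α − 1`, hence `Ω′ < Ω` and the step law `CuStep` — in the
expansion-free abstract CURVE CHART of the tree (`CurveBlowupPolygonLaws.lean`, CJS LNM 2270 Lemma 12.4:
a ring map `φ : R → R′` of regular local rings of dimension `3` with regular systems of parameters
`c = (y, u₁, u₂) ↔ (z, x, y)` and `c′`, `c′₁ = φ u₁`, `φ y = φ u₁ · y′`, `c′₂ = φ u₂`; the weak transform
`J′ = (J R′ : (φ u₁)^μ)`; hypotheses `J ⊆ (y, u₁)^μ` (the curve is permissible: `I ⊆ (x, z)^r`),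
`δ > 1` and `α ≥ 1` scaled (`L < deltaS`, `L ≤ alphaS`: the order is still `μ` at the new point), as
for the tree's `alphaS_colon_curve_add` / `betaS_colon_curve_eq` / `epsS_colon_curve_eq`, which give
`α′ = α − 1`, `β′ = β` and CJS's `ε′ = ε` already).  Cutkosky assumes more (very well prepared good
parameters, `τ = 1`, `k = k̄`); the polygon identities need only the chart, so the statements below
are his Lemma 10.13 conclusions in the generality of CJS Lemma 12.4 (4).  New here: the transport of
Cutkosky's SLOPE `ε` (both inequalities via the tree's two-sided half-plane transport
`forall_pts_colon_curve_of_forall_pts` / `curvePt_mem_pts`), and the packaging as `OmegaCu′ < OmegaCu`.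

AI-written proof of a printed statement; weaker than expert review.  No named facts.

## Sources

* S. D. Cutkosky, Amer. J. Math. 131 (2009), Def. 10.10, Lemma 10.11 (3), Lemma 10.13 (pp. 31–32);
  proof of Thm. 10.18, p. 37 l. 5–10. [Cutkosky2009]
* V. Cossart, U. Jannsen, S. Saito, LNM 2270 (2020), Lemma 12.4 (4). [CossartJannsenSaito2020]
-/

noncomputable section

open IsLocalRing

namespace Literature.AlgebraicGeometry.Resolution.Cutkosky2009

universe u

section CurveChart

variable {R R' : Type u} [CommRing R] [CommRing R'] (φ : R →+* R') {c : Fin 3 → R}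
  {c' : Fin 3 → R'} (h₁ : c' 1 = φ (c 1)) (h₀ : φ (c 0) = φ (c 1) * c' 0)
  (h₂ : c' 2 = φ (c 2))
  [IsRegularLocalRing R] [IsRegularLocalRing R']
  (hgen : Ideal.span {c 0, c 1, c 2} = maximalIdeal R) (hdim : ringKrullDim R = 3)
  (hgen' : Ideal.span {c' 0, c' 1, c' 2} = maximalIdeal R') (hdim' : ringKrullDim R' = 3)
  {J : Ideal R} {μ : ℕ}

omit [IsRegularLocalRing R] in
/-- The level form through the vertex `v = (α, β)` and a point `e` below the level `β`:
`d · spt₁ + n · spt₂` with `d = β − b > 0`, `n = a − α > 0`, is minimised over `pts` exactly on the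
line of slope `−ε` through `v` when `e` realises `ε`; in particular at `e` and every point of `pts`
lies on or above it. [cite: Cutkosky2009, §10.1 p. 28 l. 35–37] -/
theorem levelForm_le_of_slopeOf_eq_epsCu {e : Fin 3 →₀ ℕ} (he : e ∈ lowPts c J μ)
    (heq : slopeOf c J μ e = epsCu c J μ) {x : Fin 3 →₀ ℕ} (hx : x ∈ pts c J μ) :
    (betaS c J μ - spt₂ μ e) * alphaS c J μ + (spt₁ μ e - alphaS c J μ) * betaS c J μ ≤
      (betaS c J μ - spt₂ μ e) * spt₁ μ x + (spt₁ μ e - alphaS c J μ) * spt₂ μ x := by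
  have h1 := alphaS_lt_spt₁_of_mem_lowPts he
  have h2 := he.2
  have hαx : alphaS c J μ ≤ spt₁ μ x := alphaS_le hx
  -- the real inequality `β − b_x ≤ ε (a_x − α)` with `ε = d/n`
  have key := sub_le_epsCu_mul (c := c) (J := J) (μ := μ) hx
  rw [← heq] at key
  unfold slopeOf at key
  have hn : (0 : ℚ) < (spt₁ μ e : ℚ) - alphaS c J μ := by
    have : (alphaS c J μ : ℚ) < spt₁ μ e := by exact_mod_cast h1
    linarith
  rw [div_mul_eq_mul_div, le_div_iff₀ hn] at key
  -- clear denominators and return to `ℕ`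
  have hd' : ((betaS c J μ - spt₂ μ e : ℕ) : ℚ) = (betaS c J μ : ℚ) - spt₂ μ e := by
    rw [Nat.cast_sub h2.le]
  have hn' : ((spt₁ μ e - alphaS c J μ : ℕ) : ℚ) = (spt₁ μ e : ℚ) - alphaS c J μ := by
    rw [Nat.cast_sub h1.le]
  have goalQ : ((betaS c J μ - spt₂ μ e : ℕ) : ℚ) * alphaS c J μ +
      ((spt₁ μ e - alphaS c J μ : ℕ) : ℚ) * betaS c J μ ≤
      ((betaS c J μ - spt₂ μ e : ℕ) : ℚ) * spt₁ μ x + ((spt₁ μ e - alphaS c J μ : ℕ) : ℚ) * spt₂ μ x := by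
    rw [hd', hn']; nlinarith [key]
  exact_mod_cast goalQ

include h₁ h₀ h₂ hgen hdim hgen' hdim' in
/-- **Upper bound `ε′ ≤ ε`** (curve chart): every slope from the new vertex `v′ = (α − 1, β)` down
to a point of the weak transform's polygon is `≤ ε` — the half-plane of the `ε`-line descends to
`J′`. [cite: Cutkosky2009, Lemma 10.13 p. 32 l. 22–28] -/
theorem slopeOf_colon_curve_le_epsCu (hJμ : J ≤ Ideal.span {c 0, c 1} ^ μ)
    (hne : (pts c J μ).Nonempty) (hδ : μ.factorial < deltaS c J μ) (hα : μ.factorial ≤ alphaS c J μ)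
    {e' : Fin 3 →₀ ℕ} (he' : e' ∈ lowPts c' ((J.map φ).colon {φ (c 1) ^ μ}) μ) :
    slopeOf c' ((J.map φ).colon {φ (c 1) ^ μ}) μ e' ≤ epsCu c J μ := by
  have hαeq := alphaS_colon_curve_add φ h₁ h₀ h₂ hgen hdim hgen' hdim' hJμ hne hδ hα
  have hβeq := betaS_colon_curve_eq φ h₁ h₀ h₂ hgen hdim hgen' hdim' hJμ hne hδ hα
  have h1' := alphaS_lt_spt₁_of_mem_lowPts he'
  have h2' := he'.2
  rcases epsCu_eq_zero_or_exists (c := c) (J := J) (μ := μ) with h0 | ⟨e, he, heq⟩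
  · -- `ε = 0`: no point below `β`, so `β = ε_CJS`, which is preserved; contradiction with `e'`
    exfalso
    have hβε := betaS_eq_epsS_of_lowPts_eq_empty hne ((epsCu_eq_zero_iff).mp h0)
    have hεeq := epsS_colon_curve_eq φ h₁ h₀ h₂ hgen hdim hgen' hdim' hJμ hne hδ hα
    have := epsS_le he'.1
    omega
  · have h1 := alphaS_lt_spt₁_of_mem_lowPts he
    have h2 := he.2
    set d := betaS c J μ - spt₂ μ e with hd
    set n := spt₁ μ e - alphaS c J μ with hn
    have hdpos : 0 < d := by omega
    have hnpos : 0 < n := by omega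
    -- transport the half-plane `d x₁ + n x₂ ≥ d (α − L) + n β + L d`
    have hβpos : 0 < betaS c J μ := by omega
    have hS : ∀ x ∈ pts c J μ, (d * (alphaS c J μ - μ.factorial) + n * betaS c J μ) + μ.factorial * d ≤
        d * spt₁ μ x + n * spt₂ μ x := by
      intro x hx
      have := levelForm_le_of_slopeOf_eq_epsCu he heq hx
      have hsplit : d * (alphaS c J μ - μ.factorial) + μ.factorial * d = d * alphaS c J μ := by
        rw [Nat.mul_sub, mul_comm μ.factorial d]
        exact Nat.sub_add_cancel (Nat.mul_le_mul_left _ hα)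
      calc d * (alphaS c J μ - μ.factorial) + n * betaS c J μ + μ.factorial * d
          = d * alphaS c J μ + n * betaS c J μ := by omega
        _ ≤ d * spt₁ μ x + n * spt₂ μ x := by rw [hd, hn]; linarith [this]
    have hw₀ : 0 < d * (alphaS c J μ - μ.factorial) + n * betaS c J μ :=
      Nat.add_pos_right _ (Nat.mul_pos hnpos hβpos)
    have hT := forall_pts_colon_curve_of_forall_pts φ h₁ h₀ h₂ hgen hdim hgen' hdim' hw₀ hdpos hnpos
      hS e' he'.1
    -- read it as `n (β′ − b′) ≤ d (a′ − α′)` and divide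
    have hineq : (n : ℚ) * ((betaS c' ((J.map φ).colon {φ (c 1) ^ μ}) μ : ℚ) - spt₂ μ e') ≤
        (d : ℚ) * ((spt₁ μ e' : ℚ) - alphaS c' ((J.map φ).colon {φ (c 1) ^ μ}) μ) := by
      have hT' : ((d * (alphaS c J μ - μ.factorial) + n * betaS c J μ : ℕ) : ℚ) ≤
          ((d * spt₁ μ e' + n * spt₂ μ e' : ℕ) : ℚ) := by exact_mod_cast hT
      push_cast [Nat.cast_sub hα] at hT'
      have hα' : (alphaS c' ((J.map φ).colon {φ (c 1) ^ μ}) μ : ℚ) = (alphaS c J μ : ℚ) - μ.factorial := by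
        have : ((alphaS c' ((J.map φ).colon {φ (c 1) ^ μ}) μ + μ.factorial : ℕ) : ℚ) = alphaS c J μ := by
          exact_mod_cast hαeq
        push_cast at this; linarith
      rw [hβeq, hα']
      nlinarith [hT']
    have hnQ : (0 : ℚ) < (spt₁ μ e' : ℚ) - alphaS c' ((J.map φ).colon {φ (c 1) ^ μ}) μ := by
      have : (alphaS c' ((J.map φ).colon {φ (c 1) ^ μ}) μ : ℚ) < spt₁ μ e' := by exact_mod_cast h1'
      linarith
    have hεval : epsCu c J μ = (d : ℚ) / (n : ℚ) := by
      rw [← heq]; unfold slopeOf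
      rw [hd, hn, Nat.cast_sub h2.le, Nat.cast_sub h1.le]
    rw [hεval]
    unfold slopeOf
    rw [div_le_div_iff₀ hnQ (by exact_mod_cast hnpos)]
    linarith [hineq]

include h₁ h₀ h₂ hgen hdim hgen' hdim' in
/-- **Lower bound `ε ≤ ε′`** (curve chart): the Newton point realising `ε` goes up to a point of
the weak transform realising the same slope from `v′`. [cite: Cutkosky2009, Lemma 10.13 p. 32 l. 22–28] -/
theorem epsCu_le_epsCu_colon_curve (hJμ : J ≤ Ideal.span {c 0, c 1} ^ μ)
    (hne : (pts c J μ).Nonempty) (hδ : μ.factorial < deltaS c J μ) (hα : μ.factorial ≤ alphaS c J μ) :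
    epsCu c J μ ≤ epsCu c' ((J.map φ).colon {φ (c 1) ^ μ}) μ := by
  have hαeq := alphaS_colon_curve_add φ h₁ h₀ h₂ hgen hdim hgen' hdim' hJμ hne hδ hα
  have hβeq := betaS_colon_curve_eq φ h₁ h₀ h₂ hgen hdim hgen' hdim' hJμ hne hδ hα
  rcases epsCu_eq_zero_or_exists (c := c) (J := J) (μ := μ) with h0 | ⟨e, he, heq⟩
  · rw [h0]; exact epsCu_nonneg _ _ _
  · have h1 := alphaS_lt_spt₁_of_mem_lowPts he
    have h2 := he.2
    set d := betaS c J μ - spt₂ μ e with hd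
    set n := spt₁ μ e - alphaS c J μ with hn
    have hdpos : 0 < d := by omega
    have hnpos : 0 < n := by omega
    -- `e` minimises the positive form `d spt₁ + n spt₂` over `pts`
    have hmin : ∀ x ∈ pts c J μ, d * spt₁ μ e + n * spt₂ μ e ≤ d * spt₁ μ x + n * spt₂ μ x := by
      intro x hx
      have := levelForm_le_of_slopeOf_eq_epsCu he heq hx
      have hval : d * spt₁ μ e + n * spt₂ μ e = d * alphaS c J μ + n * betaS c J μ := by
        rw [hd, hn]
        zify [h1.le, h2.le]
        ring
      rw [hval, hd, hn]; linarith [this]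
    have hval : d * spt₁ μ e + n * spt₂ μ e = d * alphaS c J μ + n * betaS c J μ := by
      rw [hd, hn]; zify [h1.le, h2.le]; ring
    have hβpos : 0 < betaS c J μ := by omega
    have hpos : 0 < d * spt₁ μ e + n * spt₂ μ e := by
      rw [hval]; exact Nat.add_pos_right _ (Nat.mul_pos hnpos hβpos)
    obtain ⟨f, hf, hinit⟩ :=
      exists_isInitialTerm_levelWeight_of_isMinOn c hgen hdim hdpos hnpos he.1 hmin hpos
    -- rewrite the level weight as a curve pull-back: `ℓ(e) = w₀′ + L d` with `w₀′ > 0`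
    set w₀' := d * spt₁ μ e + n * spt₂ μ e - μ.factorial * d with hw₀'
    have hLd : μ.factorial * d ≤ d * spt₁ μ e + n * spt₂ μ e := by
      rw [hval, mul_comm]
      exact le_add_right (Nat.mul_le_mul_left _ hα)
    have hw₀pos : 0 < w₀' := by
      have : μ.factorial * d + 1 ≤ d * spt₁ μ e + n * spt₂ μ e := by
        rw [hval, mul_comm]
        have := Nat.mul_le_mul_left d hα
        have : 1 ≤ n * betaS c J μ := Nat.mul_pos hnpos hβpos
        omega
      omega
    have hwt : levelWeight μ (d * spt₁ μ e + n * spt₂ μ e) d n =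
        curvePullbackWeight (levelWeight μ w₀' d n) := by
      rw [← levelWeight_eq_curvePullbackWeight, Nat.sub_add_cancel hLd]
    rw [hwt] at hinit
    have hW' : ∀ i, 0 < levelWeight μ w₀' d n i := levelWeight_pos hw₀pos hdpos hnpos
    have hmem := curvePt_mem_pts φ h₁ h₀ h₂ _ hgen hdim hgen' hdim' hW' hJμ hf he.1.2 hinit
    -- coordinates of the image point
    have hdeg : μ ≤ e 0 + e 1 := by
      have h3 : (μ - e 0) * sfac μ e ≤ e 1 * sfac μ e := by
        rw [sub_mul_sfac he.1.2]
        have : μ.factorial ≤ spt₁ μ e := by omega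
        rwa [spt₁] at this
      have := Nat.le_of_mul_le_mul_right h3 (sfac_pos he.1.2)
      omega
    have hs1 := spt₁_curvePt_add he.1.2 hdeg
    have hs2 := spt₂_curvePt μ e
    have hlow' : curvePt μ e ∈ lowPts c' ((J.map φ).colon {φ (c 1) ^ μ}) μ :=
      ⟨hmem, by rw [hs2, hβeq]; exact h2⟩
    have hle := slopeOf_le_epsCu hlow'
    have hslope : slopeOf c' ((J.map φ).colon {φ (c 1) ^ μ}) μ (curvePt μ e) = slopeOf c J μ e := by
      unfold slopeOf
      rw [hs2, hβeq]
      have ha : (spt₁ μ (curvePt μ e) : ℚ) - alphaS c' ((J.map φ).colon {φ (c 1) ^ μ}) μ =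
          (spt₁ μ e : ℚ) - alphaS c J μ := by
        have e1 : ((spt₁ μ (curvePt μ e) + μ.factorial : ℕ) : ℚ) = spt₁ μ e := by exact_mod_cast hs1
        have e2 : ((alphaS c' ((J.map φ).colon {φ (c 1) ^ μ}) μ + μ.factorial : ℕ) : ℚ) =
            alphaS c J μ := by exact_mod_cast hαeq
        push_cast at e1 e2; linarith
      rw [ha]
    rw [← heq, ← hslope]; exact hle

include h₁ h₀ h₂ hgen hdim hgen' hdim' in
/-- **Cutkosky 2009, Lemma 10.13: `ε′ = ε`** under the blow-up of the curve (curve chart).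
[cite: Cutkosky2009, Lemma 10.13 p. 32 l. 22–28] -/
theorem epsCu_colon_curve_eq (hJμ : J ≤ Ideal.span {c 0, c 1} ^ μ)
    (hne : (pts c J μ).Nonempty) (hδ : μ.factorial < deltaS c J μ) (hα : μ.factorial ≤ alphaS c J μ) :
    epsCu c' ((J.map φ).colon {φ (c 1) ^ μ}) μ = epsCu c J μ := by
  refine le_antisymm ?_ (epsCu_le_epsCu_colon_curve φ h₁ h₀ h₂ hgen hdim hgen' hdim' hJμ hne hδ hα)
  rcases epsCu_eq_zero_or_exists (c := c') (J := (J.map φ).colon {φ (c 1) ^ μ}) (μ := μ) with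
    h0 | ⟨e', he', heq'⟩
  · rw [h0]; exact epsCu_nonneg _ _ _
  · rw [← heq']
    exact slopeOf_colon_curve_le_epsCu φ h₁ h₀ h₂ hgen hdim hgen' hdim' hJμ hne hδ hα he'

include h₁ h₀ h₂ hgen hdim hgen' hdim' in
/-- **`1/ε′ = 1/ε`** under the blow-up of the curve. [cite: Cutkosky2009, Lemma 10.13 p. 32 l. 22–28] -/
theorem invEpsCu_colon_curve_eq (hJμ : J ≤ Ideal.span {c 0, c 1} ^ μ)
    (hne : (pts c J μ).Nonempty) (hδ : μ.factorial < deltaS c J μ) (hα : μ.factorial ≤ alphaS c J μ) :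
    invEpsCu c' ((J.map φ).colon {φ (c 1) ^ μ}) μ = invEpsCu c J μ := by
  unfold invEpsCu
  rw [epsCu_colon_curve_eq φ h₁ h₀ h₂ hgen hdim hgen' hdim' hJμ hne hδ hα]

include h₁ h₀ h₂ hgen hdim hgen' hdim' in
/-- **Cutkosky 2009, proof of Theorem 10.18, case Tr3: "`α_{n+1} < α_n` and `Ω_{n+1} < Ω_n` by
Lemma 10.13"** — `Ω′ = (β, 1/ε, α − 1) < (β, 1/ε, α) = Ω` under the blow-up of the curve.
[cite: Cutkosky2009, Thm. 10.18 proof p. 37 l. 5–10; Lemma 10.13 p. 32 l. 22–28] -/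
theorem OmegaCu_colon_curve_lt (hJμ : J ≤ Ideal.span {c 0, c 1} ^ μ)
    (hne : (pts c J μ).Nonempty) (hδ : μ.factorial < deltaS c J μ) (hα : μ.factorial ≤ alphaS c J μ) :
    OmegaCu c' ((J.map φ).colon {φ (c 1) ^ μ}) μ < OmegaCu c J μ := by
  rw [lt_iff_components]
  simp only [bC_OmegaCu, mC_OmegaCu, aC_OmegaCu]
  refine Or.inr ⟨betaS_colon_curve_eq φ h₁ h₀ h₂ hgen hdim hgen' hdim' hJμ hne hδ hα,
    Or.inr ⟨invEpsCu_colon_curve_eq φ h₁ h₀ h₂ hgen hdim hgen' hdim' hJμ hne hδ hα, ?_⟩⟩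
  have := alphaS_colon_curve_add φ h₁ h₀ h₂ hgen hdim hgen' hdim' hJμ hne hδ hα
  have := Nat.factorial_pos μ
  omega

include h₁ h₀ h₂ hgen hdim hgen' hdim' in
/-- The step law `CuStep` of Theorem 10.18 holds (trivially: `ε` is unchanged) for the curve step.
[cite: Cutkosky2009, Thm. 10.18 p. 36 l. 55–72] -/
theorem cuStep_colon_curve (hJμ : J ≤ Ideal.span {c 0, c 1} ^ μ)
    (hne : (pts c J μ).Nonempty) (hδ : μ.factorial < deltaS c J μ) (hα : μ.factorial ≤ alphaS c J μ) :
    CuStep (OmegaCu c' ((J.map φ).colon {φ (c 1) ^ μ}) μ) (OmegaCu c J μ) :=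
  cuStep_OmegaCu (OmegaCu_colon_curve_lt φ h₁ h₀ h₂ hgen hdim hgen' hdim' hJμ hne hδ hα)
    (fun _ hε _ => absurd (epsCu_colon_curve_eq φ h₁ h₀ h₂ hgen hdim hgen' hdim' hJμ hne hδ hα) hε)

end CurveChart

end Literature.AlgebraicGeometry.Resolution.Cutkosky2009
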